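import Summits.Schanuel.Schanuel.Theses.RootDecomp1K
import Summits.Schanuel.Schanuel.Theorems.RootDecomp1KHyperSplit

/-!
# RootDecomp1K — round-3 glue: `LinLiouvilleSchanuel → PolyDiophantineSchanuel → StrictDiophantineSchanuel`
(lens-6 gen 8, NODE «LiouvilleCarving» round 3; glue item stmt-Schanuel-31988)

The D-0019 glue of the split of `StrictDiophantineSchanuel` (stmt-Schanuel-31078) into
`LinLiouvilleSchanuel` (A₃, stmt-Schanuel-31986) and `PolyDiophantineSchanuel` (B₃, stmt-Schanuel-31987, declared
residual): a classical case split on the predicate «`z` is Liouville as a linear form»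
(`∀ ω, ∃ h ≠ 0, ‖Σ hᵢzᵢ‖ < (1 + Σ|hᵢ|)^(−ω)`).  No transcendence input; nothing is defined here.
Port of HOME/decomp-schanuel-lens-6/g8/prover/RootDecomp1KLinLiouvilleSplit.port.lean with the `_local` copies
replaced by the route decls (route file rev 4).
-/

set_option linter.dupNamespace false

namespace Summit.Schanuel.Schanuel.Theorems.RootDecomp1KLinLiouvilleSplit

open Summit.Schanuel.Schanuel.Theses.RootDecomp1K (StrictDiophantineSchanuel CoordLiouvilleSchanuel
  LinLiouvilleSchanuel PolyDiophantineSchanuel StrictDiophantineSchanuelGlue closes)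

/-- The round-3 glue `A₃ → B₃ → StrictDiophantineSchanuel`: case split on the linear-form predicate. -/
theorem strictDiophantineSchanuel_of_linLiouville_split (hA : LinLiouvilleSchanuel)
    (hB : PolyDiophantineSchanuel) : StrictDiophantineSchanuel := by
  intro n z hz hD
  by_cases hL : ∀ ω : ℕ, ∃ h : Fin n → ℤ, h ≠ 0 ∧ ‖∑ i, (h i : ℂ) * z i‖ < 1 / (1 + ∑ i, (|h i| : ℝ)) ^ ω
  · exact hA n z hz hL
  · exact hB n z hz hD hL

/-- The glue item stmt-Schanuel-31988 as stated in the route file: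
`LinLiouvilleSchanuel → PolyDiophantineSchanuel → StrictDiophantineSchanuel`. -/
theorem strictDiophantineSchanuelGlue_holds :
    Summit.Schanuel.Schanuel.Theses.RootDecomp1K.StrictDiophantineSchanuelGlue := by
  unfold Summit.Schanuel.Schanuel.Theses.RootDecomp1K.StrictDiophantineSchanuelGlue
  exact strictDiophantineSchanuel_of_linLiouville_split

/-- Hence the live route's deciding theorem fed by the round-3 pieces. -/
theorem schanuel_of_pieces₃ (hL : CoordLiouvilleSchanuel) (hA : LinLiouvilleSchanuel)
    (hB : PolyDiophantineSchanuel) : _root_.Schanuel :=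
  Summit.Schanuel.Schanuel.Theorems.RootDecomp1KHyperSplit.schanuel_of_coord_strict hL
    (strictDiophantineSchanuel_of_linLiouville_split hA hB)

end Summit.Schanuel.Schanuel.Theorems.RootDecomp1KLinLiouvilleSplit
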